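import Literature.Analysis.FluidPDE.LerayGaugeStrainSpectrum
import Literature.Analysis.FluidPDE.TaoEnstrophyLocalisation
import Literature.Analysis.FluidPDE.TaoEnergyLocalisation
import Literature.Analysis.FluidPDE.VorticityCalculus
import Literature.Analysis.FluidPDE.LeiZhang2011HeatGaugeStream

/-!
# Crux `HodographBetchov.ClassBudgetsRegularise` (stmt-NavierStokesRegularity-16863), line `birth` —
# pointwise algebra of the velocity gradient (helpers for stub 1 `stub_classBudgetEnstrophyBound`)

Pointwise `3 × 3` linear algebra of `A = ∇v(x) : ℝ³ →L ℝ³` (`ℝ³ = EuclideanSpace ℝ (Fin 3)`),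
written over the tree's `curl` (`curl_apply_eq`), `frobeniusNormSq`, `ContinuousLinearMap.det`,
`ContinuousLinearMap.adjoint`, with `ω = curl v x`, `S = ½ (A + A†)`, `|·|_F` the Frobenius norm:

* `cubic_identity` — for trace-free `A` (divergence-free `v`):
  `∑ᵢ ⟪A eᵢ, A (A eᵢ)⟫ = 3 det A − ⟪ω, A ω⟫` (`tr (Aᵀ A²) = tr S³ − ¼ ω·Sω`, Cayley–Hamilton
  `tr S³ = 3 det S`, and `det A = det S + ¼ ω·Sω`); this is the algebra that turns the cubic term
  of the enstrophy balance into vortex stretching plus a null Lagrangian;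
* `inner_curl_sub_four_det` — `⟪ω, Aω⟫ − 4 det A = −4 det S` (any `A`; Betchov 1956);
* `neg_det_strain_le` — **Miller's Lemma 5.1 in the two-frame (Courant–Fischer) form of the
  route**: if `tr A = 0`, `m ≥ 0` and the quadratic form of `A` is `≤ m` on some orthonormal
  2-frame, then `−det S ≤ ½ m |S|²_F` (through the tree's `strainEigenvalues_mid_le_iff` and the
  eigenbasis of `A + A†`; the scalar core is `miller_scalar`);
* `fast_point_bound` — consequently `⟪ω, Aω⟫ − 4 det A ≤ 2 m |A|²_F` at such ("fast") points;
* the **effective majorant** `g = (⟪ω, Aω⟫ − 4 det A)⁺ / (2|A|²_F)` (explicit in `∇v`, hence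
  measurable for `v ∈ C¹`: `measurable_effMajorant`), with `⟪ω, Aω⟫ − 4 det A ≤ 2 g |A|²_F`
  everywhere (`effMajorant_bound`) and `g ≤ m` at fast points (`effMajorant_le`) — so that a
  possibly non-measurable hypothesis majorant `m` enters integrals only through monotonicity.

References: E. Miller, Arch. Ration. Mech. Anal. 235 (2020) = arXiv:1710.05569, Lemma 5.1;
R. Betchov, J. Fluid Mech. 1 (1956) 497–504; R. A. Horn, C. R. Johnson, *Matrix Analysis*,
Thm. 4.2.6 (Courant–Fischer).
-/

noncomputable section

open scoped InnerProductSpace RealInnerProductSpace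
open Literature.Analysis Literature.Analysis.FluidPDE

-- the summit and its single sub-problem share the name (CONVENTIONS §1), as in every Theorems file
set_option linter.dupNamespace false

namespace Summit.NavierStokesRegularity.NavierStokesRegularity.Theorems.ClassBudgetsRegularise

/-! ### Entries of a linear map of `ℝ³` in the standard basis -/

section Entries

variable (A : EuclideanSpace ℝ (Fin 3) →L[ℝ] EuclideanSpace ℝ (Fin 3))

/-- Expansion of a vector of `ℝ³` in the standard basis. [folklore] -/
theorem eq_sum_single (y : EuclideanSpace ℝ (Fin 3)) :
    y = ∑ j, y j • EuclideanSpace.single j (1 : ℝ) := by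
  have h := (EuclideanSpace.basisFun (Fin 3) ℝ).sum_repr y
  conv_lhs => rw [← h]
  refine Finset.sum_congr rfl fun j _ => ?_
  rw [EuclideanSpace.basisFun_repr, EuclideanSpace.basisFun_apply]

/-- Coordinates of `A y` through the matrix entries `(A eⱼ)ᵢ`. [folklore] -/
theorem apply_coord (y : EuclideanSpace ℝ (Fin 3)) (i : Fin 3) :
    A y i = ∑ j, A (EuclideanSpace.single j 1) i * y j := by
  conv_lhs => rw [eq_sum_single y]
  rw [map_sum, apply_eq_inner_single, sum_inner]
  refine Finset.sum_congr rfl fun j _ => ?_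
  rw [map_smul, real_inner_smul_left, ← apply_eq_inner_single, mul_comm]

/-- The determinant of `A` in terms of its entries (Sarrus). [folklore] -/
theorem det_eq_entries :
    A.det =
      A (EuclideanSpace.single 0 1) 0 * (A (EuclideanSpace.single 1 1) 1 * A (EuclideanSpace.single 2 1) 2
        - A (EuclideanSpace.single 2 1) 1 * A (EuclideanSpace.single 1 1) 2)
      - A (EuclideanSpace.single 1 1) 0 * (A (EuclideanSpace.single 0 1) 1 * A (EuclideanSpace.single 2 1) 2
        - A (EuclideanSpace.single 2 1) 1 * A (EuclideanSpace.single 0 1) 2)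
      + A (EuclideanSpace.single 2 1) 0 * (A (EuclideanSpace.single 0 1) 1 * A (EuclideanSpace.single 1 1) 2
        - A (EuclideanSpace.single 1 1) 1 * A (EuclideanSpace.single 0 1) 2) := by
  have h := LinearMap.det_toMatrix (EuclideanSpace.basisFun (Fin 3) ℝ).toBasis
    (A : EuclideanSpace ℝ (Fin 3) →ₗ[ℝ] EuclideanSpace ℝ (Fin 3))
  rw [ContinuousLinearMap.det, ← h]
  change (stdMatrix (A : EuclideanSpace ℝ (Fin 3) →ₗ[ℝ] EuclideanSpace ℝ (Fin 3))).det = _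
  rw [Matrix.det_fin_three]
  simp only [stdMatrix_apply, ContinuousLinearMap.coe_coe]
  ring

/-- The trace of `A` in terms of its diagonal entries. [folklore] -/
theorem trace_eq_entries :
    LinearMap.trace ℝ _ (A : EuclideanSpace ℝ (Fin 3) →ₗ[ℝ] EuclideanSpace ℝ (Fin 3)) =
      A (EuclideanSpace.single 0 1) 0 + A (EuclideanSpace.single 1 1) 1 +
        A (EuclideanSpace.single 2 1) 2 := by
  rw [LinearMap.trace_eq_sum_inner _ (EuclideanSpace.basisFun (Fin 3) ℝ), Fin.sum_univ_three]
  simp only [EuclideanSpace.basisFun_apply, ContinuousLinearMap.coe_coe,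
    EuclideanSpace.inner_single_left, map_one, one_mul]

/-- The squared Frobenius norm of `A` is the sum of the squares of its entries. [folklore] -/
theorem frob_eq_entries :
    frobeniusNormSq A = ∑ i, ∑ j, (A (EuclideanSpace.single j 1) i) ^ 2 := by
  rw [frobeniusNormSq_eq_sum_sq_stdMatrix]
  simp only [stdMatrix_apply, ContinuousLinearMap.coe_coe]

/-- The entries of the adjoint are the transposed entries. [folklore] -/
theorem adjoint_entry (i j : Fin 3) :
    (ContinuousLinearMap.adjoint A) (EuclideanSpace.single j 1) i = A (EuclideanSpace.single i 1) j := by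
  rw [apply_eq_inner_single, ContinuousLinearMap.adjoint_inner_left, EuclideanSpace.inner_single_left,
    map_one, one_mul]

end Entries

/-! ### The cubic term of the enstrophy balance and Betchov's pointwise split -/

/-- **The cubic identity** `∑ᵢ ⟪A eᵢ, A (A eᵢ)⟫ = 3 det A − ⟪ω, A ω⟫` for a trace-free velocity
gradient `A = ∇v(x)` (`div v (x) = 0`), `ω = curl v x`: `tr (Aᵀ A²) = tr S³ − ¼ ω·Sω`,
`tr S³ = 3 det S` for trace-free `S` (Cayley–Hamilton) and `det A = det S + ¼ ω·Sω`. [folklore] -/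
theorem cubic_identity (v : EuclideanSpace ℝ (Fin 3) → EuclideanSpace ℝ (Fin 3)) (x : EuclideanSpace ℝ (Fin 3))
    (htr : VectorCalculus.divergence v x = 0) :
    ∑ i, ⟪fderiv ℝ v x (EuclideanSpace.basisFun (Fin 3) ℝ i),
        fderiv ℝ v x (fderiv ℝ v x (EuclideanSpace.basisFun (Fin 3) ℝ i))⟫ =
      3 * (fderiv ℝ v x).det - ⟪curl v x, fderiv ℝ v x (curl v x)⟫ := by
  set A := fderiv ℝ v x with hA
  obtain ⟨hc0, hc1, hc2⟩ := curl_apply_eq v x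
  have inner_eq_sum3 : ∀ a b : EuclideanSpace ℝ (Fin 3), ⟪a, b⟫ = a 0 * b 0 + a 1 * b 1 + a 2 * b 2 :=
    fun a b => by rw [EuclideanSpace.inner_eq_star_dotProduct]; simp [dotProduct, Fin.sum_univ_three, mul_comm]
  change LinearMap.trace ℝ _ (A : EuclideanSpace ℝ (Fin 3) →ₗ[ℝ] EuclideanSpace ℝ (Fin 3)) = 0 at htr
  rw [trace_eq_entries] at htr
  have h22 : A (EuclideanSpace.single 2 1) 2 =
      -(A (EuclideanSpace.single 0 1) 0 + A (EuclideanSpace.single 1 1) 1) := by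
    linarith
  rw [Fin.sum_univ_three]
  simp only [EuclideanSpace.basisFun_apply, inner_eq_sum3, det_eq_entries]
  rw [← hA] at hc0 hc1 hc2
  simp only [apply_coord A (A _), apply_coord A (curl v x), Fin.sum_univ_three, hc0, hc1, hc2]
  rw [h22]
  ring

/-- **Betchov's pointwise split** `⟪ω, A ω⟫ − 4 det A = −4 det S`, `S = ½ (A + A†)`, for an
arbitrary velocity gradient `A = ∇v(x)` (no trace condition; `det (S + Ω) = det S + ¼ ω·Sω` for
`Ω y = ½ ω × y`). [cite: Betchov1956, §3] -/
theorem inner_curl_sub_four_det (v : EuclideanSpace ℝ (Fin 3) → EuclideanSpace ℝ (Fin 3))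
    (x : EuclideanSpace ℝ (Fin 3)) :
    ⟪curl v x, fderiv ℝ v x (curl v x)⟫ - 4 * (fderiv ℝ v x).det =
      -4 * ((1 / 2 : ℝ) • (fderiv ℝ v x + ContinuousLinearMap.adjoint (fderiv ℝ v x))).det := by
  set A := fderiv ℝ v x with hA
  obtain ⟨hc0, hc1, hc2⟩ := curl_apply_eq v x
  have inner_eq_sum3 : ∀ a b : EuclideanSpace ℝ (Fin 3), ⟪a, b⟫ = a 0 * b 0 + a 1 * b 1 + a 2 * b 2 :=
    fun a b => by rw [EuclideanSpace.inner_eq_star_dotProduct]; simp [dotProduct, Fin.sum_univ_three, mul_comm]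
  rw [← hA] at hc0 hc1 hc2
  rw [det_eq_entries A, det_eq_entries ((1 / 2 : ℝ) • (A + ContinuousLinearMap.adjoint A))]
  simp only [FunLike.coe_smul, FunLike.coe_add, Pi.smul_apply,
    Pi.add_apply, PiLp.smul_apply, PiLp.add_apply, smul_eq_mul, adjoint_entry, inner_eq_sum3,
    apply_coord A (curl v x), Fin.sum_univ_three, hc0, hc1, hc2]
  ring

/-! ### Miller's inequality `−det S ≤ ½ λ₂⁺ |S|²` in the two-frame form -/

/-- The scalar core of Miller's Lemma 5.1: for `a ≥ b ≥ c` with `a + b + c = 0`, `m ≥ 0` and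
`b ≤ 2m`, `−abc ≤ m (a² + b² + c²)`. [cite: Miller2019, Lemma 5.1] -/
theorem miller_scalar {a b c m : ℝ} (hab : b ≤ a) (hbc : c ≤ b) (hsum : a + b + c = 0)
    (hm : 0 ≤ m) (hmid : b ≤ 2 * m) :
    -(a * b * c) ≤ m * (a ^ 2 + b ^ 2 + c ^ 2) := by
  rcases le_or_gt b 0 with hb | hb
  · -- `c ≤ b ≤ 0 ≤ a`: the product is nonnegative
    have ha : 0 ≤ a := by linarith
    have hbc' : 0 ≤ b * c := mul_nonneg_of_nonpos_of_nonpos hb (hbc.trans hb)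
    have h1 : 0 ≤ a * b * c := by rw [mul_assoc]; exact mul_nonneg ha hbc'
    have h2 : 0 ≤ m * (a ^ 2 + b ^ 2 + c ^ 2) := by positivity
    linarith
  · -- `0 < b ≤ a`, `c = -(a + b)`
    have hc : c = -(a + b) := by linarith
    have ha : 0 < a := hb.trans_le hab
    have hq : 0 ≤ a ^ 2 + a * b := by positivity
    have h1 : b * (a ^ 2 + a * b) ≤ 2 * m * (a ^ 2 + a * b) := mul_le_mul_of_nonneg_right hmid hq
    rw [hc]
    nlinarith [sq_nonneg b, h1]

/-- **Miller 2019, Lemma 5.1, in the route's two-frame form.** Let `A : ℝ³ →L ℝ³` be trace free and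
let `m ≥ 0` bound the quadratic form of `A` on some orthonormal 2-frame:
`⟪A (αv + βw), αv + βw⟫ ≤ m (α² + β²)` for all `α, β`. Then, with `S = ½ (A + A†)`,
`−det S ≤ ½ m |S|²_F`. Proof: by Courant–Fischer (`strainEigenvalues_mid_le_iff`) the middle
eigenvalue of `S` is `≤ m`; in the orthonormal eigenbasis of `A + A†` (eigenvalues
`μ₀ ≥ μ₁ ≥ μ₂`, `∑ μᵢ = 2 tr A = 0`, `μ₁ ≤ 2m`) one has `det S = ∏ μᵢ/2`, `|S|²_F = ∑ (μᵢ/2)²`, and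
the claim is `miller_scalar`. [cite: Miller2019, Lemma 5.1] -/
theorem neg_det_strain_le (A : EuclideanSpace ℝ (Fin 3) →L[ℝ] EuclideanSpace ℝ (Fin 3))
    (htr : LinearMap.trace ℝ _ (A : EuclideanSpace ℝ (Fin 3) →ₗ[ℝ] EuclideanSpace ℝ (Fin 3)) = 0)
    {m : ℝ} (hm : 0 ≤ m)
    (hcl : ∃ v w : EuclideanSpace ℝ (Fin 3), ‖v‖ = 1 ∧ ‖w‖ = 1 ∧ ⟪v, w⟫ = 0 ∧
      ∀ α β : ℝ, ⟪A (α • v + β • w), α • v + β • w⟫ ≤ m * (α ^ 2 + β ^ 2)) :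
    -((1 / 2 : ℝ) • (A + ContinuousLinearMap.adjoint A)).det ≤
      m / 2 * frobeniusNormSq ((1 / 2 : ℝ) • (A + ContinuousLinearMap.adjoint A)) := by
  set AL : EuclideanSpace ℝ (Fin 3) →ₗ[ℝ] EuclideanSpace ℝ (Fin 3) :=
    (A : EuclideanSpace ℝ (Fin 3) →ₗ[ℝ] EuclideanSpace ℝ (Fin 3)) with hAL
  have h3 : Module.finrank ℝ (EuclideanSpace ℝ (Fin 3)) = 3 := finrank_euclideanSpace_fin
  have hT := isSymmetric_addAdjoint AL
  set μ : Fin 3 → ℝ := hT.eigenvalues h3 with hμ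
  set b := hT.eigenvectorBasis h3 with hb
  -- the middle eigenvalue (Courant–Fischer, two-frame form)
  have hmid : μ 1 ≤ 2 * m := by
    have h := (strainEigenvalues_mid_le_iff AL h3 m).2 (by
      obtain ⟨v, w, hv, hw, hvw, h⟩ := hcl
      exact ⟨v, w, hv, hw, hvw, fun α β => by simpa [hAL] using h α β⟩)
    rw [strainEigenvalues_def] at h
    change 2⁻¹ * μ 1 ≤ m at h
    linarith
  -- ordering and trace
  have h01 : μ 1 ≤ μ 0 := hT.eigenvalues_antitone h3 (by decide : (0 : Fin 3) ≤ 1)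
  have h12 : μ 2 ≤ μ 1 := hT.eigenvalues_antitone h3 (by decide : (1 : Fin 3) ≤ 2)
  have hTb : ∀ i, addAdjoint AL (b i) = μ i • b i := fun i => hT.apply_eigenvectorBasis h3 i
  have hsum : μ 0 + μ 1 + μ 2 = 0 := by
    have h1 : LinearMap.trace ℝ _ (addAdjoint AL) = ∑ i, μ i := by
      rw [LinearMap.trace_eq_sum_inner _ b]
      refine Finset.sum_congr rfl fun i _ => ?_
      rw [hTb, real_inner_smul_right, real_inner_self_eq_norm_sq, b.orthonormal.1 i]; ring
    have h2 : LinearMap.trace ℝ _ (addAdjoint AL) = 2 * LinearMap.trace ℝ _ AL := by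
      rw [LinearMap.trace_eq_sum_inner (addAdjoint AL) b, LinearMap.trace_eq_sum_inner AL b,
        Finset.mul_sum]
      refine Finset.sum_congr rfl fun i _ => ?_
      rw [addAdjoint_apply, inner_add_right, LinearMap.adjoint_inner_right, real_inner_comm]; ring
    rw [← Fin.sum_univ_three, ← h1, h2, htr, mul_zero]
  -- the strain operator `S = ½ (A + A†)` acts diagonally in the eigenbasis
  set S := (1 / 2 : ℝ) • (A + ContinuousLinearMap.adjoint A) with hS
  have hSb : ∀ i, S (b i) = (μ i / 2) • b i := by
    intro i
    have h := hTb i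
    rw [addAdjoint_apply] at h
    change A (b i) + ContinuousLinearMap.adjoint A (b i) = μ i • b i at h
    have h2 : S (b i) = (1 / 2 : ℝ) • (A (b i) + ContinuousLinearMap.adjoint A (b i)) := by
      simp only [hS, FunLike.coe_smul, FunLike.coe_add, Pi.smul_apply, Pi.add_apply]
    rw [h2, h, smul_smul]
    congr 1; ring
  -- determinant and Frobenius norm in the eigenbasis
  have hdet : S.det = (μ 0 / 2) * (μ 1 / 2) * (μ 2 / 2) := by
    have hM : LinearMap.toMatrix b.toBasis b.toBasis (S : EuclideanSpace ℝ (Fin 3) →ₗ[ℝ] _) =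
        Matrix.diagonal fun i => μ i / 2 := by
      ext i j
      rw [LinearMap.toMatrix_apply, ContinuousLinearMap.coe_coe, OrthonormalBasis.coe_toBasis, hSb,
        OrthonormalBasis.coe_toBasis_repr_apply, map_smul, b.repr_self, Matrix.diagonal_apply]
      by_cases hij : i = j
      · subst hij; simp
      · simp [hij]
    rw [ContinuousLinearMap.det, ← LinearMap.det_toMatrix b.toBasis, hM, Matrix.det_diagonal,
      Fin.prod_univ_three]
  have hfrob : frobeniusNormSq S = (μ 0 / 2) ^ 2 + (μ 1 / 2) ^ 2 + (μ 2 / 2) ^ 2 := by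
    rw [frobeniusNormSq_eq_sum b, Fin.sum_univ_three, hSb, hSb, hSb, norm_smul, norm_smul, norm_smul,
      b.orthonormal.1 0, b.orthonormal.1 1, b.orthonormal.1 2]
    simp only [Real.norm_eq_abs, mul_one, div_pow, sq_abs]
  rw [hdet, hfrob]
  have key := miller_scalar h01 h12 hsum hm hmid
  nlinarith [key]

/-- `|S|²_F ≤ |A|²_F` for the symmetric part `S = ½ (A + A†)`. [folklore] -/
theorem frobeniusNormSq_strain_le (A : EuclideanSpace ℝ (Fin 3) →L[ℝ] EuclideanSpace ℝ (Fin 3)) :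
    frobeniusNormSq ((1 / 2 : ℝ) • (A + ContinuousLinearMap.adjoint A)) ≤ frobeniusNormSq A := by
  rw [frob_eq_entries, frob_eq_entries A]
  simp only [Fin.sum_univ_three, FunLike.coe_smul, FunLike.coe_add, Pi.smul_apply, Pi.add_apply,
    PiLp.smul_apply, PiLp.add_apply, smul_eq_mul, adjoint_entry]
  nlinarith [sq_nonneg (A (EuclideanSpace.single 0 1) 1 - A (EuclideanSpace.single 1 1) 0),
    sq_nonneg (A (EuclideanSpace.single 0 1) 2 - A (EuclideanSpace.single 2 1) 0),
    sq_nonneg (A (EuclideanSpace.single 1 1) 2 - A (EuclideanSpace.single 2 1) 1)]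

/-- **The fast-point bound** (Betchov's split + Miller's Lemma 5.1): at a point where
`div v = 0` and the quadratic form of `∇v(x)` is `≤ m` (`m ≥ 0`) on some orthonormal 2-frame,
`⟪ω, ∇v ω⟫ − 4 det ∇v ≤ 2 m |∇v|²_F` (`= −4 det S ≤ 2m|S|²_F ≤ 2m|∇v|²_F`). The signature is
the registered helper stub of the crux item. [cite: Miller2019, Lemma 5.1] -/
theorem fast_point_bound : ∀ (v : EuclideanSpace ℝ (Fin 3) → EuclideanSpace ℝ (Fin 3))
    (x : EuclideanSpace ℝ (Fin 3)), VectorCalculus.divergence v x = 0 → ∀ m : ℝ, 0 ≤ m →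
    (∃ a b : EuclideanSpace ℝ (Fin 3), ‖a‖ = 1 ∧ ‖b‖ = 1 ∧ inner ℝ a b = 0 ∧
      ∀ α β : ℝ, inner ℝ (fderiv ℝ v x (α • a + β • b)) (α • a + β • b) ≤ m * (α ^ 2 + β ^ 2)) →
    inner ℝ (curl v x) (fderiv ℝ v x (curl v x)) - 4 * (fderiv ℝ v x).det ≤
      2 * m * frobeniusNormSq (fderiv ℝ v x) := by
  intro v x hdiv m hm hcl
  rw [inner_curl_sub_four_det]
  have h1 := neg_det_strain_le (fderiv ℝ v x) hdiv hm hcl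
  have h2 := frobeniusNormSq_strain_le (fderiv ℝ v x)
  nlinarith [h1, h2]

/-! ### The effective (measurable) majorant `g = (⟪ω, Aω⟫ − 4 det A)⁺ / (2 |A|²_F)` -/

/-- The effective majorant is nonnegative. [folklore] -/
theorem effMajorant_nonneg (v : EuclideanSpace ℝ (Fin 3) → EuclideanSpace ℝ (Fin 3))
    (x : EuclideanSpace ℝ (Fin 3)) :
    0 ≤ max 0 (⟪curl v x, fderiv ℝ v x (curl v x)⟫ - 4 * (fderiv ℝ v x).det) /
      (2 * frobeniusNormSq (fderiv ℝ v x)) :=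
  div_nonneg (le_max_left _ _) (mul_nonneg zero_le_two (frobeniusNormSq_nonneg _))

/-- The effective majorant `g` dominates: `⟪ω, Aω⟫ − 4 det A ≤ 2 g |A|²_F` at EVERY point
(tautological off `A = 0`; at `A = 0` both sides vanish). [folklore] -/
theorem effMajorant_bound (v : EuclideanSpace ℝ (Fin 3) → EuclideanSpace ℝ (Fin 3))
    (x : EuclideanSpace ℝ (Fin 3)) :
    ⟪curl v x, fderiv ℝ v x (curl v x)⟫ - 4 * (fderiv ℝ v x).det ≤
      2 * (max 0 (⟪curl v x, fderiv ℝ v x (curl v x)⟫ - 4 * (fderiv ℝ v x).det) /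
        (2 * frobeniusNormSq (fderiv ℝ v x))) * frobeniusNormSq (fderiv ℝ v x) := by
  set A := fderiv ℝ v x with hA
  set Q := ⟪curl v x, A (curl v x)⟫ - 4 * A.det with hQ
  rcases eq_or_lt_of_le (frobeniusNormSq_nonneg A) with h0 | hpos
  · -- `A = 0`
    have hA0 : A = 0 := (frobeniusNormSq_eq_zero_iff A).1 h0.symm
    have hP : ⟪curl v x, A (curl v x)⟫ = 0 := by rw [hA0]; simp
    have hd : A.det = 0 := by rw [det_eq_entries A, hA0]; simp
    have hQ0 : Q = 0 := by rw [hQ, hP, hd]; ring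
    rw [hQ0, ← h0]; simp
  · have key : 2 * (max 0 Q / (2 * frobeniusNormSq A)) * frobeniusNormSq A = max 0 Q := by
      field_simp
    rw [key]
    exact le_max_right _ _

/-- At a fast point (`div v = 0`, two-frame bound `m ≥ 0`) the effective majorant is `≤ m`
(`fast_point_bound` divided by `2|A|²_F`). [cite: Miller2019, Lemma 5.1] -/
theorem effMajorant_le (v : EuclideanSpace ℝ (Fin 3) → EuclideanSpace ℝ (Fin 3))
    (x : EuclideanSpace ℝ (Fin 3)) (hdiv : VectorCalculus.divergence v x = 0) {m : ℝ} (hm : 0 ≤ m)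
    (hcl : ∃ a b : EuclideanSpace ℝ (Fin 3), ‖a‖ = 1 ∧ ‖b‖ = 1 ∧ ⟪a, b⟫ = 0 ∧
      ∀ α β : ℝ, ⟪fderiv ℝ v x (α • a + β • b), α • a + β • b⟫ ≤ m * (α ^ 2 + β ^ 2)) :
    max 0 (⟪curl v x, fderiv ℝ v x (curl v x)⟫ - 4 * (fderiv ℝ v x).det) /
      (2 * frobeniusNormSq (fderiv ℝ v x)) ≤ m := by
  set A := fderiv ℝ v x with hA
  have hfast := fast_point_bound v x hdiv m hm hcl
  rw [← hA] at hfast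
  rcases eq_or_lt_of_le (frobeniusNormSq_nonneg A) with h0 | hpos
  · rw [← h0]; simpa using hm
  · rw [div_le_iff₀ (by positivity), max_le_iff]
    exact ⟨by positivity, by linarith⟩

/-- The effective majorant of a `C¹` field is (Borel) measurable — it is an explicit expression in
the continuous field `∇v`. [folklore] -/
theorem measurable_effMajorant {v : EuclideanSpace ℝ (Fin 3) → EuclideanSpace ℝ (Fin 3)}
    (hv : ContDiff ℝ 1 v) :
    Measurable fun x => max 0 (⟪curl v x, fderiv ℝ v x (curl v x)⟫ - 4 * (fderiv ℝ v x).det) /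
      (2 * frobeniusNormSq (fderiv ℝ v x)) := by
  have cD : Continuous (fderiv ℝ v) := hv.continuous_fderiv one_ne_zero
  have cω : Continuous (curl v) := continuous_curl hv
  have cP : Continuous fun x => ⟪curl v x, fderiv ℝ v x (curl v x)⟫ := cω.inner (cD.clm_apply cω)
  have cdet : Continuous fun x => (fderiv ℝ v x).det := ContinuousLinearMap.continuous_det.comp cD
  have cF : Continuous fun x => frobeniusNormSq (fderiv ℝ v x) :=
    continuous_frobeniusNormSq_clm.comp cD
  exact ((continuous_const.max (cP.sub (continuous_const.mul cdet))).measurable).div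
    ((continuous_const.mul cF).measurable)

end Summit.NavierStokesRegularity.NavierStokesRegularity.Theorems.ClassBudgetsRegularise

end
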